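import Literature.NumberTheory.IwasawaTheory.WeakLeopoldtCyclotomicAssembly
import Literature.NumberTheory.IwasawaTheory.WeakLeopoldtCyclotomicStageKilling
import Literature.NumberTheory.GaloisRepresentations.RestrictedRamificationInflationKernelStage
import Literature.NumberTheory.GaloisRepresentations.UnramifiedRadicalDescentOpen
import HarnessLib

/-!
# Weak Leopoldt for the cyclotomic `ℤ_p`-extension is a THEOREM of the Literature tree
# (NSW (10.3.25) / Iwasawa 1973): `weakLeopoldt_H2_subsingleton_cyclotomic_of_isOpen_holds`

Topic `NumberTheory/IwasawaTheory`; namespace `Literature.NumberTheory.IwasawaTheory`.  Theorems only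
(no definition, no named fact, no instance; D-0026).  Last file of the `WeakLeopoldtCyclotomic*` group
(width seats `bsd-line-x1-p1-w2` gen 7/8 of cell `bsd-eis`, D-0154 (2) INPUTS lane): the named fact
`weakLeopoldt_H2_subsingleton_cyclotomic_of_isOpen` (`WeakLeopoldtCyclotomic.lean`:
`H²(Gal(K_Σ/K′K^{cyc}_∞), D) = 0` for every `K′ ⊆ K_Σ` finite over the number field `K`, `p` odd,
`S ⊇ {v ∣ p}`, `D ≃ ℚ_p/ℤ_p` with the trivial action) is DISCHARGED here, at its Literature home, from
LITERATURE theorems only (so that Literature files can build on it):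

* §1 `mu_eq_self_of_mem_inf_ker` — the stages `U₀ ⊓ ker χ̄_{p^k}` act trivially on `μ_{p^a}`, `a ≤ k`;
* §2 **`stagesDie`** — the finite-level killing statement of `WeakLeopoldtCyclotomicLevels.lean` /
  `WeakLeopoldtCyclotomicAssembly.lean` (the hypothesis of
  `weakLeopoldt_H2_subsingleton_cyclotomic_of_isOpen_of_stagesDie`, VERBATIM): a continuous
  `2`-cocycle of the stage `Gal(K_S/K′(μ_{p^k}))` with values in a finite `A ≤ D` killed by `p^a`,
  `a ≤ k`, becomes on a deeper stage, read in `D`, a continuous coboundary.  Proof = the arithmetic of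
  NSW (10.3.25): read `A` inside `μ_{p^a}(K̄)` (`WeakLeopoldtCyclotomicStages.exists_muCarrier_embedding_extension`),
  kill the Brauer part of the inflated class on a deeper stage
  (`WeakLeopoldtCyclotomicStageKilling.exists_stage_resSub_inflation_eq_zero`, from the tree's
  cyclotomic-layer killing of Serre II §4.4), kill the `S`-ideal-class part by enlarging the
  coefficients to `μ_{p^{a+t}}` (`GaloisRepresentations.exists_twoCoboundary_stage_of_resSub_inflation_eq_zero`
  — the `ker(inf²)` calculus of NSW (8.3.11) (ii) — fed with radical descent at the open stage,
  `GaloisRepresentations.radicalDescent_of_isOpen`, and Kummer theory over `K_S`), descend to a stage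
  fixing `μ_{p^{a+t}}` and read back in `D`;
* §3 **`weakLeopoldt_H2_subsingleton_cyclotomic_of_isOpen_holds`**.

The same mathematics was first assembled on the Summits side (cell `bsd-eis`, seat `-w4` gen 15:
`Summits/BirchSwinnertonDyer/…/Theorems/EisensteinPrimesGoodLatticeBDPValueStagesDie.lean`,
`…CycWLStagePrep.lean`), which Literature files cannot import; this file is the upstream home.
HONEST FRAMING: a theorem of Iwasawa (1973) / NSW (10.3.25); class-field-theory-free proof
(Brauer groups of number fields over the cyclotomic tower + finiteness of class groups via radical
descent); no conjecture is touched.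

References: [NeukirchSchmidtWingberg2008] (10.3.25), (10.3.22), (8.3.11) (ii); [Iwasawa1973] §2;
[SerreGaloisCohomology1997] II §4.4 Prop. 13, I §2.2 Prop. 8, I §2.4 Prop. 9; [NguyenQuangDo1984]
Thm. 2.2; [Greenberg2006] pp. 343–344.
-/

noncomputable section

open scoped Classical
open NumberField IsDedekindDomain Field
open Literature.NumberTheory.GaloisRepresentations
open Literature.NumberTheory.GaloisRepresentations.DiscreteGaloisModule
open Literature.NumberTheory.EllipticCurves (ZpExtension)
open Literature.NumberTheory.IwasawaTheory.Greenberg2006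
open _root_.TopRep _root_.ContRepresentation _root_.ContinuousCohomology

namespace Literature.NumberTheory.IwasawaTheory

/-! ### §1. The stages act trivially on `μ_{p^a}`, `a ≤ k` -/

section Trivial

variable {K : Type} [Field K] [CharZero K] (p : ℕ) [hp : Fact p.Prime]

/-- An element of `F_k = ker χ̄_{p^k}` fixes `μ_{p^a}` pointwise for `a ≤ k` (as elements of the Galois
module `MuCarrier K (p^a)`). [cite: Washington1997, §13.1] -/
theorem mu_eq_self_of_mem_ker {k a : ℕ} (hak : a ≤ k) {σ : absoluteGaloisGroup K}
    (hσ : σ ∈ (modNCyclotomicCharacter K (p ^ k)).ker) (v : MuCarrier K (p ^ a)) :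
    mu K (p ^ a) σ v = v := by
  apply muVal_injective K (p ^ a)
  rw [muVal_apply]
  have hpow : ((muVal K (p ^ a) v : (AlgebraicClosure K)ˣ) : AlgebraicClosure K) ^ p ^ k = 1 := by
    obtain ⟨d, hd⟩ := pow_dvd_pow p hak
    rw [hd, pow_mul, ← Units.val_pow_eq_pow_val, muVal_pow_eq_one, Units.val_one, one_pow]
  exact Units.ext (by rw [Units.coe_smul]; exact smul_eq_self_of_mem_ker_modNCyclotomicCharacter p hσ hpow)

/-- An element of the stage subgroup `U₀ ⊓ F_k` fixes `μ_{p^a}` pointwise for `a ≤ k`.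
[cite: Washington1997, §13.1] -/
theorem mu_eq_self_of_mem_inf_ker (U₀ : Subgroup (absoluteGaloisGroup K)) {k a : ℕ} (hak : a ≤ k)
    {σ : absoluteGaloisGroup K} (hσ : σ ∈ U₀ ⊓ (modNCyclotomicCharacter K (p ^ k)).ker)
    (v : MuCarrier K (p ^ a)) : mu K (p ^ a) σ v = v :=
  mu_eq_self_of_mem_ker p hak (Subgroup.mem_inf.mp hσ).2 v

end Trivial

/-! ### §2. The finite-level killing statement «stagesDie» -/

section StagesDie

variable {K : Type} [Field K] [NumberField K] (p : ℕ) [hp : Fact p.Prime]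
  (S : Set (HeightOneSpectrum (𝓞 K)))

set_option maxHeartbeats 400000 in
/-- **«stagesDie»** — the finite-level killing statement of the cyclotomic weak Leopoldt assembly
(hypothesis of `weakLeopoldt_H2_subsingleton_cyclotomic_of_isOpen_of_stagesDie`, verbatim, for ONE
`K`): `K` a number field, `p ≠ 2`, `S ⊇ {v ∣ p}` (finite), `U₀ ≤ Γ_K` open with `N_S ≤ U₀`,
`D ≃+ ℚ_p/ℤ_p` discrete; for `a ≤ k`, a finite `A ≤ D` killed by `p^a` and a continuous `2`-cocycle `c`
of the stage `Gal(K_S/K′(μ_{p^k})) = galoisGroupAbove S (U₀ ⊓ ker χ̄_{p^k})` with values in `A`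
(trivial action), there are `k' ≥ k` and a continuous `b : Gal(K_S/K′(μ_{p^{k'}})) → D` with
`c(σ, τ) = b(τ) − b(στ) + b(σ)` in `D` on the deeper stage.  PROOF (NSW (10.3.25)): §1 + the
coefficient bookkeeping `exists_muCarrier_embedding_extension` (read `A ↪ μ_{p^a}(K̄)`) + the Brauer
killing `exists_stage_resSub_inflation_eq_zero` (a deeper stage `k₁` where the inflated class
restricts to zero) + `exists_twoCoboundary_stage_of_resSub_inflation_eq_zero` with
`radicalDescent_of_isOpen` at the open stage `U₀ ⊓ F_{k₁}` (a `μ_{p^{a+t}}`-valued coboundary) + the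
stage `k' = max k₁ (a+t)` (trivial action on `μ_{p^{a+t}}`) + the extension `μ_{p^{a+t}} → D`.
[cite: NeukirchSchmidtWingberg2008, (10.3.25) (proof), (8.3.11) (ii)] [cite: Iwasawa1973, §2]
[cite: SerreGaloisCohomology1997, II §4.4 Prop. 13] -/
theorem stagesDie (hp2 : p ≠ 2)
    (hS : ∀ v : HeightOneSpectrum (𝓞 K), ((p : ℕ) : 𝓞 K) ∈ v.asIdeal → v ∈ S)
    (U₀ : Subgroup (absoluteGaloisGroup K)) (hU₀ : IsOpen (U₀ : Set (absoluteGaloisGroup K)))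
    (hN : ramificationSubgroup K S ≤ U₀)
    (D : Type) [AddCommGroup D] [TopologicalSpace D] [DiscreteTopology D]
    (hD : Nonempty (D ≃+ ℚ_[p] ⧸ (PadicInt.subring p).toAddSubgroup))
    (k a : ℕ) (hak : a ≤ k) (A : AddSubgroup D) [Finite A] (hA : ∀ x ∈ A, p ^ a • x = 0)
    (c : contTwoCocycles (((ContinuousRep.trivial (GaloisGroupUnramifiedOutside K S) ℤ A).restrict
      (subgroupIncl (galoisGroupAbove S (U₀ ⊓ (modNCyclotomicCharacter K (p ^ k)).ker)))).toTopRep)) :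
    ∃ (k' : ℕ) (hkk' : k ≤ k')
      (b : C(galoisGroupAbove S (U₀ ⊓ (modNCyclotomicCharacter K (p ^ k')).ker), D)),
      ∀ σ τ : galoisGroupAbove S (U₀ ⊓ (modNCyclotomicCharacter K (p ^ k')).ker),
        ((c.1 (Subgroup.inclusion
            (galoisGroupAbove_inf_ker_modNCyclotomicCharacter_antitone p S U₀ hkk') σ,
          Subgroup.inclusion
            (galoisGroupAbove_inf_ker_modNCyclotomicCharacter_antitone p S U₀ hkk') τ) : A) : D) =
          b τ - b (σ * τ) + b σ := by
  -- the degenerate level `k = 0`: `a = 0`, `A = 0`, `c = 0`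
  rcases Nat.eq_zero_or_pos k with hk0 | hkpos
  · subst hk0
    have ha0 : a = 0 := Nat.le_zero.mp hak
    have hA0 : ∀ x : A, (x : D) = 0 := fun x ↦ by
      have h := hA x x.2
      rwa [ha0, pow_zero, one_smul] at h
    exact ⟨0, le_rfl, 0, fun σ τ ↦ by simp only [ContinuousMap.zero_apply, sub_zero, add_zero, hA0]⟩
  have hk : 1 ≤ k := hkpos
  -- notation: the level subgroups and the stage `H = U₀ ⊓ F_k`
  have hHo : IsOpen ((U₀ ⊓ (modNCyclotomicCharacter K (p ^ k)).ker : Subgroup (absoluteGaloisGroup K)) :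
      Set (absoluteGaloisGroup K)) := hU₀.inter (isOpen_ker_modNCyclotomicCharacter p k)
  have hH : IsClosed ((U₀ ⊓ (modNCyclotomicCharacter K (p ^ k)).ker : Subgroup (absoluteGaloisGroup K)) :
      Set (absoluteGaloisGroup K)) := Subgroup.isClosed_of_isOpen _ hHo
  haveI : CompactSpace (galoisGroupAbove S (U₀ ⊓ (modNCyclotomicCharacter K (p ^ k)).ker)) :=
    compactSpace_galoisGroupAbove S _ hH
  -- (i) coefficients: `A ↪ μ_{p^a}(K̄)`, with the ways back `μ_{p^{a+t}}(K̄) → D`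
  obtain ⟨e, -, hg⟩ := exists_muCarrier_embedding_extension K p hD A hA
  -- (ii) the `μ_{p^a}`-valued stage cocycle, for the TRIVIAL (= descended, §1) action
  let ρG : ContinuousRep (galoisGroupAbove S (U₀ ⊓ (modNCyclotomicCharacter K (p ^ k)).ker)) ℤ
      (MuCarrier K (p ^ a)) := ContinuousRep.trivial _ ℤ _
  have hρG : ∀ (σ : (U₀ ⊓ (modNCyclotomicCharacter K (p ^ k)).ker : Subgroup (absoluteGaloisGroup K)))
      (v : MuCarrier K (p ^ a)),
      ρG ⟨toUnramifiedQuot K S (σ : absoluteGaloisGroup K), coe_mem_galoisGroupAbove S _ σ⟩ v =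
        mu K (p ^ a) (σ : absoluteGaloisGroup K) v := fun σ v ↦ by
    rw [ContinuousRep.trivial_apply, mu_eq_self_of_mem_inf_ker p U₀ hak σ.2 v]
  let f : contTwoCocycles ρG.toTopRep :=
    ⟨⟨fun q ↦ e (c.1 q), continuous_of_discreteTopology.comp c.1.continuous⟩, fun σ τ υ ↦ by
      have h := c.2 σ τ υ
      rw [ContinuousRep.toTopRep_ρ_apply, ContinuousRep.restrict_apply, subgroupIncl_apply,
        ContinuousRep.trivial_apply] at h
      rw [ContinuousRep.toTopRep_ρ_apply, ContinuousRep.trivial_apply]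
      simp only [ContinuousMap.coe_mk, ← map_add, h]⟩
  have hf : ∀ q, f.1 q = e (c.1 q) := fun _ ↦ rfl
  -- (iii) Brauer killing: a deeper stage `k₁` on which the inflated class restricts to zero
  obtain ⟨k₁, hkk₁, hT, infl, hinfl, hres⟩ :=
    exists_stage_resSub_inflation_eq_zero p S hp2 U₀ hU₀ hk ρG hρG f hH
  -- (iv) radical descent at the OPEN stage `T = U₀ ⊓ F_{k₁}` and the `ker(inf²)` calculus
  have hTH : U₀ ⊓ (modNCyclotomicCharacter K (p ^ k₁)).ker ≤ U₀ ⊓ (modNCyclotomicCharacter K (p ^ k)).ker :=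
    inf_le_inf_left U₀ (ker_modNCyclotomicCharacter_antitone p hkk₁)
  have hTo : IsOpen ((U₀ ⊓ (modNCyclotomicCharacter K (p ^ k₁)).ker : Subgroup (absoluteGaloisGroup K)) :
      Set (absoluteGaloisGroup K)) := hU₀.inter (isOpen_ker_modNCyclotomicCharacter p k₁)
  have hNT : ramificationSubgroup K S ≤ U₀ ⊓ (modNCyclotomicCharacter K (p ^ k₁)).ker :=
    le_inf hN (ramificationSubgroup_le_ker_modNCyclotomicCharacter p S hS k₁)
  obtain ⟨t, hRD⟩ := radicalDescent_of_isOpen K hS hTo hNT a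
  obtain ⟨bμ, hbμ⟩ := exists_twoCoboundary_stage_of_resSub_inflation_eq_zero S hS hTH hT hH hNT
    (a := a) (t := t) hRD ρG hρG f infl hinfl hres
  -- (v) the way back `μ_{p^{a+t}}(K̄) → D`
  obtain ⟨g, hge⟩ := hg t
  -- (vi) the deeper stage `k' = max k₁ (a + t)`, where `μ_{p^{a+t}}` is fixed
  have hk₁k' : k₁ ≤ max k₁ (a + t) := le_max_left _ _
  have hkk' : k ≤ max k₁ (a + t) := hkk₁.trans hk₁k'
  have hT'T : U₀ ⊓ (modNCyclotomicCharacter K (p ^ max k₁ (a + t))).ker ≤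
      U₀ ⊓ (modNCyclotomicCharacter K (p ^ k₁)).ker :=
    inf_le_inf_left U₀ (ker_modNCyclotomicCharacter_antitone p hk₁k')
  have hincl : galoisGroupAbove S (U₀ ⊓ (modNCyclotomicCharacter K (p ^ max k₁ (a + t))).ker) ≤
      galoisGroupAbove S (U₀ ⊓ (modNCyclotomicCharacter K (p ^ k₁)).ker) :=
    galoisGroupAbove_inf_ker_modNCyclotomicCharacter_antitone p S U₀ hk₁k'
  let b : C(galoisGroupAbove S (U₀ ⊓ (modNCyclotomicCharacter K (p ^ max k₁ (a + t))).ker), D) :=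
    ⟨fun x ↦ g (bμ (Subgroup.inclusion hincl x)),
      continuous_of_discreteTopology.comp (bμ.continuous.comp (continuous_inclusion hincl))⟩
  have hbapp : ∀ x, b x = g (bμ (Subgroup.inclusion hincl x)) := fun _ ↦ rfl
  refine ⟨max k₁ (a + t), hkk', b, fun σ τ ↦ ?_⟩
  -- lift `σ, τ` to the stage subgroup of `Γ_K`
  obtain ⟨⟨σ₀, hσ₀⟩, rfl⟩ := galoisGroupAbove_mk_surjective S _ σ
  obtain ⟨⟨τ₀, hτ₀⟩, rfl⟩ := galoisGroupAbove_mk_surjective S _ τ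
  -- the `(B)`-identity at the pair `(σ₀, τ₀)`, read at the level `k₁`
  have hστ := hbμ ⟨σ₀, hT'T hσ₀⟩ ⟨τ₀, hT'T hτ₀⟩
  -- the action on `μ_{p^{a+t}}` is trivial at the stage `k'`
  rw [mu_eq_self_of_mem_inf_ker p U₀ (le_max_right k₁ (a + t)) hσ₀] at hστ
  -- read in `D` through `g`
  have hD := congrArg g hστ
  rw [hf, hge, map_add, map_sub] at hD
  -- identify the points
  have h1 : (c.1 (Subgroup.inclusion (galoisGroupAbove_inf_ker_modNCyclotomicCharacter_antitone p S U₀ hkk')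
        ⟨toUnramifiedQuot K S σ₀, coe_mem_galoisGroupAbove S _ ⟨σ₀, hσ₀⟩⟩,
      Subgroup.inclusion (galoisGroupAbove_inf_ker_modNCyclotomicCharacter_antitone p S U₀ hkk')
        ⟨toUnramifiedQuot K S τ₀, coe_mem_galoisGroupAbove S _ ⟨τ₀, hτ₀⟩⟩) : D) =
      (c.1 (⟨toUnramifiedQuot K S σ₀, coe_mem_galoisGroupAbove S _
          (⟨σ₀, hTH (hT'T hσ₀)⟩ : (U₀ ⊓ (modNCyclotomicCharacter K (p ^ k)).ker : Subgroup _))⟩,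
        ⟨toUnramifiedQuot K S τ₀, coe_mem_galoisGroupAbove S _
          (⟨τ₀, hTH (hT'T hτ₀)⟩ : (U₀ ⊓ (modNCyclotomicCharacter K (p ^ k)).ker : Subgroup _))⟩) : D) := rfl
  rw [h1, hD, hbapp, hbapp, hbapp]
  -- the three points of the deeper stage, included into the stage `k₁`
  have eσ : Subgroup.inclusion hincl
      (⟨toUnramifiedQuot K S σ₀, coe_mem_galoisGroupAbove S _ ⟨σ₀, hσ₀⟩⟩ :
        galoisGroupAbove S (U₀ ⊓ (modNCyclotomicCharacter K (p ^ max k₁ (a + t))).ker)) =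
      ⟨toUnramifiedQuot K S σ₀, coe_mem_galoisGroupAbove S _
        (⟨σ₀, hT'T hσ₀⟩ : (U₀ ⊓ (modNCyclotomicCharacter K (p ^ k₁)).ker : Subgroup _))⟩ := rfl
  have eτ : Subgroup.inclusion hincl
      (⟨toUnramifiedQuot K S τ₀, coe_mem_galoisGroupAbove S _ ⟨τ₀, hτ₀⟩⟩ :
        galoisGroupAbove S (U₀ ⊓ (modNCyclotomicCharacter K (p ^ max k₁ (a + t))).ker)) =
      ⟨toUnramifiedQuot K S τ₀, coe_mem_galoisGroupAbove S _
        (⟨τ₀, hT'T hτ₀⟩ : (U₀ ⊓ (modNCyclotomicCharacter K (p ^ k₁)).ker : Subgroup _))⟩ := rfl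
  have eστ : Subgroup.inclusion hincl
      ((⟨toUnramifiedQuot K S σ₀, coe_mem_galoisGroupAbove S _ ⟨σ₀, hσ₀⟩⟩ :
          galoisGroupAbove S (U₀ ⊓ (modNCyclotomicCharacter K (p ^ max k₁ (a + t))).ker)) *
        ⟨toUnramifiedQuot K S τ₀, coe_mem_galoisGroupAbove S _ ⟨τ₀, hτ₀⟩⟩) =
      ⟨toUnramifiedQuot K S ((⟨σ₀, hT'T hσ₀⟩ * ⟨τ₀, hT'T hτ₀⟩ :
          (U₀ ⊓ (modNCyclotomicCharacter K (p ^ k₁)).ker : Subgroup _)) : absoluteGaloisGroup K),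
        coe_mem_galoisGroupAbove S _ _⟩ := by
    apply Subtype.ext
    show toUnramifiedQuot K S σ₀ * toUnramifiedQuot K S τ₀ = toUnramifiedQuot K S (σ₀ * τ₀)
    rw [map_mul]
  rw [eσ, eτ, eστ]

end StagesDie

/-! ### §3. The named fact discharged -/

/-- **Weak Leopoldt for the cyclotomic `ℤ_p`-extension holds** (Iwasawa 1973; NSW (10.3.25) with
(10.3.22); Nguyen Quang Do 1984 Thm. 2.2; Greenberg 2006 pp. 343–344): the named fact
`weakLeopoldt_H2_subsingleton_cyclotomic_of_isOpen` of `WeakLeopoldtCyclotomic.lean` —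
`H²(Gal(K_Σ/K′K^{cyc}_∞), D) = 0` for every number field `K`, odd prime `p`, finite `S ⊇ {v ∣ p}`,
cyclotomic `κ`, open `U₀ ≥ N_S` and discrete `D ≃ ℚ_p/ℤ_p` with the trivial action (inert scalars) —
is a THEOREM: `stagesDie` fed into `weakLeopoldt_H2_subsingleton_cyclotomic_of_isOpen_of_stagesDie`.
[cite: NeukirchSchmidtWingberg2008, (10.3.25) with (10.3.22)] [cite: Iwasawa1973, §2]
[cite: NguyenQuangDo1984, Thm. 2.2] [cite: Greenberg2006, pp. 343–344] -/
theorem weakLeopoldt_H2_subsingleton_cyclotomic_of_isOpen_holds :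
    weakLeopoldt_H2_subsingleton_cyclotomic_of_isOpen :=
  weakLeopoldt_H2_subsingleton_cyclotomic_of_isOpen_of_stagesDie
    fun _ _ _ p _ hp2 S _ hS U₀ hU₀ hN D _ _ _ hD k a hak A _ hA c ↦
      stagesDie p S hp2 hS U₀ hU₀ hN D hD k a hak A hA c

end Literature.NumberTheory.IwasawaTheory

end
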